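import Summits.CriticalPhenomena.PercolationContinuityZ3.Theorems.PercNearOneGluingNoHeavyLowerTailSahiCTCLadderThreeRowThreePrep
import HarnessLib

/-!
# `NoHeavyLowerTail` (crux stmt-CriticalPhenomena-4575), P3 lane: per-cube bounds for the row `#dbl = 3` of `(L_3)`

Support file (seat `prim-l12-p3`, gen 26; `--supports stmt-CriticalPhenomena-4575`).  Paper proof `prim-l12-p3/ROW3-PROOF-g26.md` §3.
The cubes of the row (`…LadderThreeRowThreePrep`) are Kleitman surpluses of LINKS at one point `b` of 3-live up-sets, i.e. of 2-live pairs
(`upFam b`); this file transports the TRIANGLE and DEGREE lemmas of `…SahiCTCKleitmanDegree` to that form (`card_add_one_le_kap_single_of_triangle`,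
`card_add_one_le_kap_single_of_nbrs` — the latter at ANY vertex with an explicit set of common neighbours), records the LOOP bounds for the
1-live cubes (`one_le_kapL1_of_dbl_mem`, `one_le_kapL1_of_C`) and the two bounds of the 2-live cubes used by the accounting: the α-triangle
`d_j d_k y` (`tau_add_two_le_kapL2_of_triangle`) and the degree at a doubled vertex (`card_add_one_le_kapL2_of_nbrs`); and the two blocks of the
PEEL chain of `κ_R` (`sum_le_peelSum_of_core`: constant bounds; `le_two_mul_peelSum_of_core`: triangle bounds `#s'+1` along the e = 3 points).
Nothing is asserted about the crux.
-/

namespace Summit.CriticalPhenomena.PercolationContinuityZ3.Theorems.SahiCTCForms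

open Finset MvPolynomial SahiCTCGenFun SahiCTCWeightedLYM

variable {α : Type*} [DecidableEq α] [Fintype α]

section RowThreeBounds
variable {𝒳 𝒵 : Finset (Finset α)}

/-- **TRIANGLE for a link**: if the link of the 3-live pair at `b` has a common triangle `xyz ⊆ s` (i.e. `b+xy, b+yz, b+xz ∈ 𝒳 ∩ 𝒵`)
then `κ({b}, s) ≥ #s + 1`. [this work] -/
theorem card_add_one_le_kap_single_of_triangle (h𝒳 : IsUpperSet (𝒳 : Set (Finset α))) (h𝒵 : IsUpperSet (𝒵 : Set (Finset α)))
    (hX3 : ∀ S ∈ 𝒳, 3 ≤ #S) (hZ3 : ∀ S ∈ 𝒵, 3 ≤ #S) {b : α} {s : Finset α} {x y z : α} (hx : x ∈ s) (hy : y ∈ s) (hz : z ∈ s)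
    (hxy : insert b {x, y} ∈ 𝒳 ∧ insert b {x, y} ∈ 𝒵) (hyz : insert b {y, z} ∈ 𝒳 ∧ insert b {y, z} ∈ 𝒵)
    (hxz : insert b {x, z} ∈ 𝒳 ∧ insert b {x, z} ∈ 𝒵) (hxy' : x ≠ y) (hyz' : y ≠ z) (hxz' : x ≠ z) :
    (#s : ℤ) + 1 ≤ kap 𝒳 𝒵 {b} s := by
  rw [show ({b} : Finset α) = insert b ∅ from rfl, ← kap_upFam]
  have hX2 : ∀ U ∈ upFam b 𝒳, 2 ≤ #U := fun U hU => by have := upFam_live hX3 U hU; omega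
  have hZ2 : ∀ U ∈ upFam b 𝒵, 2 ≤ #U := fun U hU => by have := upFam_live hZ3 U hU; omega
  exact card_add_one_le_kap_of_triangle (isUpperSet_upFam h𝒳) (isUpperSet_upFam h𝒵) hX2 hZ2 hx hy hz
    (mem_inter.2 ⟨mem_upFam.2 hxy.1, mem_upFam.2 hxy.2⟩) (mem_inter.2 ⟨mem_upFam.2 hyz.1, mem_upFam.2 hyz.2⟩)
    (mem_inter.2 ⟨mem_upFam.2 hxz.1, mem_upFam.2 hxz.2⟩) hxy' hyz' hxz'

/-- **DEGREE for a link, at any vertex**: if `v ∈ s` (`#s ≥ 3`) and `S ⊆ s∖v` is a nonempty set of common neighbours of `v` in the link at `b`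
(`b+vu ∈ 𝒳 ∩ 𝒵` for `u ∈ S`) then `κ({b}, s) ≥ #S + 1`. [this work] -/
theorem card_add_one_le_kap_single_of_nbrs (h𝒳 : IsUpperSet (𝒳 : Set (Finset α))) (h𝒵 : IsUpperSet (𝒵 : Set (Finset α)))
    (hX3 : ∀ S ∈ 𝒳, 3 ≤ #S) (hZ3 : ∀ S ∈ 𝒵, 3 ≤ #S) {b v : α} {s S : Finset α} (hs : 3 ≤ #s) (hv : v ∈ s) (hS : S ⊆ s.erase v)
    (hSW : ∀ u ∈ S, insert b {v, u} ∈ 𝒳 ∧ insert b {v, u} ∈ 𝒵) (hS0 : S.Nonempty) :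
    (#S : ℤ) + 1 ≤ kap 𝒳 𝒵 {b} s := by
  rw [show ({b} : Finset α) = insert b ∅ from rfl, ← kap_upFam]
  have hX2 : ∀ U ∈ upFam b 𝒳, 2 ≤ #U := fun U hU => by have := upFam_live hX3 U hU; omega
  have hZ2 : ∀ U ∈ upFam b 𝒵, 2 ≤ #U := fun U hU => by have := upFam_live hZ3 U hU; omega
  have hsub : S ⊆ cnbrs (upFam b 𝒳) (upFam b 𝒵) s v := fun u hu =>
    mem_cnbrs.2 ⟨⟨mem_of_mem_erase (hS hu), ne_of_mem_erase (hS hu)⟩, mem_upFam.2 (hSW u hu).1, mem_upFam.2 (hSW u hu).2⟩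
  obtain ⟨u, hu⟩ := hS0
  have h := card_cnbrs_add_one_le_kap (isUpperSet_upFam h𝒳) (isUpperSet_upFam h𝒵) hX2 hZ2 (#s) s v rfl hs hv ⟨u, hsub hu⟩
  have hc : (#S : ℤ) ≤ #(cnbrs (upFam b 𝒳) (upFam b 𝒵) s v) := by exact_mod_cast card_le_card hsub
  linarith

/-! #### The 1-live cubes: loops -/

omit [Fintype α] in
/-- LOOP bound for `κ₁(d,Q)` from a common loop `u ∈ {d} ∪ (T∖Q)` (`(D∖d) + u ∈ 𝒳 ∩ 𝒵`). [this work] -/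
theorem one_le_kapL1_of_loop (h𝒳 : IsUpperSet (𝒳 : Set (Finset α))) (h𝒵 : IsUpperSet (𝒵 : Set (Finset α)))
    (hX3 : ∀ S ∈ 𝒳, 3 ≤ #S) (hZ3 : ∀ S ∈ 𝒵, 3 ≤ #S) {m : α →₀ ℕ} (hD : #(dbl m) = 3) {d : α} (hd : d ∈ dbl m) {Q : Finset α}
    {u : α} (hu : u ∈ insert d (lev m 1 \ Q)) (huX : insert u ((dbl m).erase d) ∈ 𝒳) (huZ : insert u ((dbl m).erase d) ∈ 𝒵) :
    1 ≤ kapL1 𝒳 𝒵 m d Q := by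
  unfold kapL1
  have h2 : #((dbl m).erase d) = 2 := by rw [card_erase_of_mem hd, hD]
  exact one_le_kap_of_loop h𝒳 h𝒵 (fun h => by have := hX3 _ h; omega) (fun h => by have := hZ3 _ h; omega) hu huX huZ

omit [Fintype α] in
/-- The α-loop: if `D ∈ 𝒳 ∩ 𝒵` then every 1-live cube has `κ₁(d,Q) ≥ 1`. [this work] -/
theorem one_le_kapL1_of_dbl_mem (h𝒳 : IsUpperSet (𝒳 : Set (Finset α))) (h𝒵 : IsUpperSet (𝒵 : Set (Finset α)))
    (hX3 : ∀ S ∈ 𝒳, 3 ≤ #S) (hZ3 : ∀ S ∈ 𝒵, 3 ≤ #S) {m : α →₀ ℕ} (hD : #(dbl m) = 3) {d : α} (hd : d ∈ dbl m) (Q : Finset α)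
    (hDX : dbl m ∈ 𝒳) (hDZ : dbl m ∈ 𝒵) : 1 ≤ kapL1 𝒳 𝒵 m d Q :=
  one_le_kapL1_of_loop h𝒳 h𝒵 hX3 hZ3 hD hd (mem_insert_self _ _) (by rwa [insert_erase hd]) (by rwa [insert_erase hd])

omit [Fintype α] in
/-- A C-loop: if `(D∖d) + y ∈ 𝒳 ∩ 𝒵` for some `y ∈ T∖Q` then `κ₁(d,Q) ≥ 1`. [this work] -/
theorem one_le_kapL1_of_C (h𝒳 : IsUpperSet (𝒳 : Set (Finset α))) (h𝒵 : IsUpperSet (𝒵 : Set (Finset α)))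
    (hX3 : ∀ S ∈ 𝒳, 3 ≤ #S) (hZ3 : ∀ S ∈ 𝒵, 3 ≤ #S) {m : α →₀ ℕ} (hD : #(dbl m) = 3) {d : α} (hd : d ∈ dbl m) {Q : Finset α}
    {y : α} (hy : y ∈ lev m 1 \ Q) (hyX : insert y ((dbl m).erase d) ∈ 𝒳) (hyZ : insert y ((dbl m).erase d) ∈ 𝒵) :
    1 ≤ kapL1 𝒳 𝒵 m d Q :=
  one_le_kapL1_of_loop h𝒳 h𝒵 hX3 hZ3 hD hd (mem_insert_of_mem hy) hyX hyZ

/-! #### The 2-live cubes: the α-triangle and the degree at a doubled vertex -/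

omit [Fintype α] in
/-- The point set of the 2-live cube `(d, y₀)` has `τ + 1` points. [this work] -/
theorem card_cubeL2 {m : α →₀ ℕ} (hD : #(dbl m) = 3) {d : α} (hd : d ∈ dbl m) {y₀ : α} (hy₀ : y₀ ∈ lev m 1) :
    #((dbl m).erase d ∪ (lev m 1).erase y₀) = #(lev m 1) + 1 := by
  rw [card_union_of_disjoint (Disjoint.mono (erase_subset _ _) (erase_subset _ _) (disjoint_dbl_lev_one m)),
    card_erase_of_mem hd, hD, card_erase_of_mem hy₀]
  have : 1 ≤ #(lev m 1) := card_pos.2 ⟨y₀, hy₀⟩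
  omega

/-- **α-TRIANGLE**: if `D ∈ 𝒳 ∩ 𝒵` and some `y ∈ T∖y₀` satisfies `d+d'+y ∈ 𝒳 ∩ 𝒵` for both other doubled points `d', d''`
(i.e. `y ∈ C_j ∩ C_k`), then `κ₂(d,y₀) ≥ τ + 2`. [this work] -/
theorem tau_add_two_le_kapL2_of_triangle (h𝒳 : IsUpperSet (𝒳 : Set (Finset α))) (h𝒵 : IsUpperSet (𝒵 : Set (Finset α)))
    (hX3 : ∀ S ∈ 𝒳, 3 ≤ #S) (hZ3 : ∀ S ∈ 𝒵, 3 ≤ #S) {m : α →₀ ℕ} (hD : #(dbl m) = 3) {d : α} (hd : d ∈ dbl m) {y₀ : α}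
    (hy₀ : y₀ ∈ lev m 1) {x x' y : α} (hx : x ∈ (dbl m).erase d) (hx' : x' ∈ (dbl m).erase d) (hxx' : x ≠ x')
    (hy : y ∈ (lev m 1).erase y₀) (hDX : dbl m ∈ 𝒳) (hDZ : dbl m ∈ 𝒵)
    (hxy : insert d {x, y} ∈ 𝒳 ∧ insert d {x, y} ∈ 𝒵) (hx'y : insert d {x', y} ∈ 𝒳 ∧ insert d {x', y} ∈ 𝒵) :
    (#(lev m 1) : ℤ) + 2 ≤ kapL2 𝒳 𝒵 m d y₀ := by
  unfold kapL2
  have hDeq : insert d {x, x'} = dbl m := by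
    apply eq_of_subset_of_card_le
    · exact insert_subset hd (insert_subset (mem_of_mem_erase hx) (singleton_subset_iff.2 (mem_of_mem_erase hx')))
    · rw [hD, card_insert_of_notMem, card_pair hxx']
      simp only [mem_insert, mem_singleton, not_or]
      exact ⟨(ne_of_mem_erase hx).symm, (ne_of_mem_erase hx').symm⟩
  have hyD : y ∉ dbl m := fun h => disjoint_left.1 (disjoint_dbl_lev_one m) h (mem_of_mem_erase hy)
  have hxy' : x ≠ y := fun h => hyD (h ▸ mem_of_mem_erase hx)
  have hx'y' : x' ≠ y := fun h => hyD (h ▸ mem_of_mem_erase hx')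
  have h := card_add_one_le_kap_single_of_triangle h𝒳 h𝒵 hX3 hZ3 (s := (dbl m).erase d ∪ (lev m 1).erase y₀)
    (mem_union_left _ hx) (mem_union_left _ hx') (mem_union_right _ hy)
    (by rw [hDeq]; exact ⟨hDX, hDZ⟩) hx'y (by exact hxy) hxx' hx'y' hxy'
  · rw [card_cubeL2 hD hd hy₀] at h; push_cast at h; linarith

/-- **DEGREE at a doubled vertex**: for `x ∈ D∖d` and a set `S ⊆ ((D∖d) ∪ (T∖y₀))∖x` of common neighbours of `x` in the link at `d`
(`d+x+u ∈ 𝒳 ∩ 𝒵`), `κ₂(d,y₀) ≥ #S + 1` (`τ ≥ 1`). [this work] -/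
theorem card_add_one_le_kapL2_of_nbrs (h𝒳 : IsUpperSet (𝒳 : Set (Finset α))) (h𝒵 : IsUpperSet (𝒵 : Set (Finset α)))
    (hX3 : ∀ S ∈ 𝒳, 3 ≤ #S) (hZ3 : ∀ S ∈ 𝒵, 3 ≤ #S) {m : α →₀ ℕ} (hD : #(dbl m) = 3) {d : α} (hd : d ∈ dbl m) {y₀ : α}
    (hy₀ : y₀ ∈ lev m 1) (hτ : 2 ≤ #(lev m 1)) {v : α} (hv : v ∈ (dbl m).erase d ∪ (lev m 1).erase y₀) {S : Finset α}
    (hS : S ⊆ ((dbl m).erase d ∪ (lev m 1).erase y₀).erase v) (hSW : ∀ u ∈ S, insert d {v, u} ∈ 𝒳 ∧ insert d {v, u} ∈ 𝒵)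
    (hS0 : S.Nonempty) : (#S : ℤ) + 1 ≤ kapL2 𝒳 𝒵 m d y₀ := by
  unfold kapL2
  exact card_add_one_le_kap_single_of_nbrs h𝒳 h𝒵 hX3 hZ3 (by rw [card_cubeL2 hD hd hy₀]; omega) hv hS hSW hS0

/-! #### Blocks of the PEEL chain -/

omit [Fintype α] in
/-- `peelSum` of a concatenation. [this work] -/
theorem peelSum_append {D : Finset α} : ∀ (l₁ l₂ : List α) (s : Finset α),
    peelSum 𝒳 𝒵 D s (l₁ ++ l₂) = peelSum 𝒳 𝒵 D s l₁ + peelSum 𝒳 𝒵 D (s \ l₁.toFinset) l₂ := by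
  intro l₁
  induction l₁ with
  | nil => intro l₂ s; simp [peelSum]
  | cons y l ih =>
    intro l₂ s
    simp only [List.cons_append, peelSum, ih, List.toFinset_cons, sdiff_insert, erase_sdiff_comm, add_assoc]

omit [Fintype α] in
/-- **Constant block**: if every link along the list is bounded below by `c y` as soon as the core `K` is still present, then
`Σ c ≤ peelSum`. [this work] -/
theorem sum_le_peelSum_of_core {D K : Finset α} (c : α → ℤ) : ∀ (l : List α) (s : Finset α), K ⊆ s → Disjoint K l.toFinset →
    (∀ y ∈ l, ∀ s' : Finset α, K ⊆ s' → c y ≤ kap 𝒳 𝒵 (insert y D) s') → (l.map c).sum ≤ peelSum 𝒳 𝒵 D s l := by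
  intro l
  induction l with
  | nil => intro s _ _ _; simp [peelSum]
  | cons y l ih =>
    intro s hK hdis hc
    rw [List.toFinset_cons, disjoint_insert_right] at hdis
    simp only [List.map_cons, List.sum_cons, peelSum]
    have h1 := hc y List.mem_cons_self (s.erase y) (fun k hk => mem_erase.2 ⟨fun h => hdis.1 (h ▸ hk), hK hk⟩)
    have h2 := ih (s.erase y) (fun k hk => mem_erase.2 ⟨fun h => hdis.1 (h ▸ hk), hK hk⟩) hdis.2
      (fun y' hy' => hc y' (List.mem_cons_of_mem _ hy'))
    linarith

omit [Fintype α] in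
/-- **Triangle block**: if every link along the list satisfies `κ(D + y, s') ≥ #s' + 1` whenever the core `K` is present, then
`2·peelSum ≥ L·(2·#s + 1) − L²` along a list of length `L` of points of `s` (the `j`-th link lives on `#s − j` points). [this work] -/
theorem le_two_mul_peelSum_of_core {D K : Finset α} : ∀ (l : List α) (s : Finset α), l.Nodup → (∀ y ∈ l, y ∈ s) → K ⊆ s →
    Disjoint K l.toFinset → (∀ y ∈ l, ∀ s' : Finset α, K ⊆ s' → (#s' : ℤ) + 1 ≤ kap 𝒳 𝒵 (insert y D) s') →
    (l.length : ℤ) * (2 * #s + 1) - (l.length : ℤ) ^ 2 ≤ 2 * peelSum 𝒳 𝒵 D s l := by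
  intro l
  induction l with
  | nil => intro s _ _ _ _ _; simp [peelSum]
  | cons y l ih =>
    intro s hnd hls hK hdis hc
    rw [List.toFinset_cons, disjoint_insert_right] at hdis
    have hy : y ∈ s := hls y List.mem_cons_self
    have hyl : y ∉ l := (List.nodup_cons.1 hnd).1
    simp only [List.length_cons, peelSum, Nat.cast_add, Nat.cast_one]
    have hKe : K ⊆ s.erase y := fun k hk => mem_erase.2 ⟨fun h => hdis.1 (h ▸ hk), hK hk⟩
    have h1 := hc y List.mem_cons_self (s.erase y) hKe
    have h2 := ih (s.erase y) (List.nodup_cons.1 hnd).2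
      (fun y' hy' => mem_erase.2 ⟨fun h => hyl (h ▸ hy'), hls y' (List.mem_cons_of_mem _ hy')⟩) hKe hdis.2
      (fun y' hy' => hc y' (List.mem_cons_of_mem _ hy'))
    have hcard : (#(s.erase y) : ℤ) = #s - 1 := by
      rw [card_erase_of_mem hy]; have := card_pos.2 ⟨y, hy⟩; omega
    rw [hcard] at h1 h2
    nlinarith [h1, h2]

end RowThreeBounds

end Summit.CriticalPhenomena.PercolationContinuityZ3.Theorems.SahiCTCForms
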